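import Summits.Ventures.PercRepro.S1TriangleVCount
import Summits.Ventures.PercRepro.S1FiveCircuitX2C
import Summits.Ventures.PercRepro.S1CellCaps5

/-!
# PercRepro — the cells `(7, 36)` and `(7, 37)` of the `q = 4` window, by LEMMAS V, W′ and X⁺ (p2, gen 18)

At `n = 43, 44` LEMMA V gives `s₃ ≤ 205 / 215`, LEMMA W′ the curve `s₄ ≤ ⌊(n(n−1)(n−2) − 2n·s₃)/8⌋` and LEMMA X⁺,
with its `s₄`-term dropped, the curve `s₅ ≤ ⌊(24·C(n,4) − (6·C(n−3,2) + 16(n−3))·s₃)/20⌋` — `(2961840 − 5320·s₃)/20`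
and `(3258024 − 5576·s₃)/20` — for the ACTUAL `s₃`. The three-cap cell inequality `cellOK14 7 d s₃ S(s₃) S5(s₃)`
holds along each curve (kernel tables of `206 / 216` cells; the twin's worst ratios `0.9788 / 0.9202`), so the
`e`-free cores of rank `7` with `43` and `44` points satisfy `RLS` at level `4`: the row `p = 7` now ends at `(7, 35)`.

* `cell_seven_thirtysix_table`, `cell_seven_thirtyseven_table` — the kernel tables;
* **`c025_core_seven_thirtysix`**, **`c025_core_seven_thirtyseven`** — the cores.
Axioms: standard.
-/

open scoped Matroid

namespace PercRepro

namespace S1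

open Set

variable {α : Type}

/-- The cells `(7, 36)` along the curves of LEMMAS W′ and X⁺: for every `s₃ ≤ 205`. -/
theorem cell_seven_thirtysix_table :
    ∀ P < 206, cellOK14 7 36 P ((74046 - 86 * P) / 8) ((2961840 - 5320 * P) / 20) = true := by
  decide +kernel

/-- The cells `(7, 37)` along the curves of LEMMAS W′ and X⁺: for every `s₃ ≤ 215`. -/
theorem cell_seven_thirtyseven_table :
    ∀ P < 216, cellOK14 7 37 P ((79464 - 88 * P) / 8) ((3258024 - 5576 * P) / 20) = true := by
  decide +kernel

/-- **THE CELL `(7, 36)`**: an `e`-free core of rank `7` with `43` points satisfies `RLS` at level `4`. -/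
theorem c025_core_seven_thirtysix (M : Matroid α) [M.Finite] (hR : M.eRank = (7 : ℕ)) (hn : M.E.ncard = 43)
    (hfree : ∀ e ∈ M.E, ∃ A ⊆ M.E \ {e}, e ∉ M.closure A ∧ e ∉ M.closure ((M.E \ {e}) \ A)) :
    ThmN.RLS M 7 4 := by
  have hP : {C : Set α | M.IsCircuit C ∧ C.ncard = 3}.ncard ≤ 205 := by
    have h := core_ncard_triangles_le_sq_div_nine M hfree
    rw [hn] at h
    exact h.trans (by norm_num)
  have hW := core_eight_mul_ncard_fourCircuits_add_le M hfree
  rw [hn] at hW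
  have hS : {C : Set α | M.IsCircuit C ∧ C.ncard = 4}.ncard ≤
      (74046 - 86 * {C : Set α | M.IsCircuit C ∧ C.ncard = 3}.ncard) / 8 := by
    rw [Nat.le_div_iff_mul_le (by norm_num)]
    omega
  have hX := core_twenty_mul_ncard_fiveCircuits_add_le M hfree
  rw [hn, show Nat.choose (43 - 3) 2 = 780 by decide, show Nat.choose 43 4 = 123410 by decide] at hX
  have hS5 : {C : Set α | M.IsCircuit C ∧ C.ncard = 5}.ncard ≤
      (2961840 - 5320 * {C : Set α | M.IsCircuit C ∧ C.ncard = 3}.ncard) / 20 := by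
    rw [Nat.le_div_iff_mul_le (by norm_num)]
    omega
  exact rls_of_cellOK14 M 7 36 _ _ _ (by norm_num) hR hn hfree le_rfl hS hS5 (by norm_num)
    (cell_seven_thirtysix_table _ (by omega))

/-- **THE CELL `(7, 37)`**: an `e`-free core of rank `7` with `44` points satisfies `RLS` at level `4`. -/
theorem c025_core_seven_thirtyseven (M : Matroid α) [M.Finite] (hR : M.eRank = (7 : ℕ)) (hn : M.E.ncard = 44)
    (hfree : ∀ e ∈ M.E, ∃ A ⊆ M.E \ {e}, e ∉ M.closure A ∧ e ∉ M.closure ((M.E \ {e}) \ A)) :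
    ThmN.RLS M 7 4 := by
  have hP : {C : Set α | M.IsCircuit C ∧ C.ncard = 3}.ncard ≤ 215 := by
    have h := core_ncard_triangles_le_sq_div_nine M hfree
    rw [hn] at h
    exact h.trans (by norm_num)
  have hW := core_eight_mul_ncard_fourCircuits_add_le M hfree
  rw [hn] at hW
  have hS : {C : Set α | M.IsCircuit C ∧ C.ncard = 4}.ncard ≤
      (79464 - 88 * {C : Set α | M.IsCircuit C ∧ C.ncard = 3}.ncard) / 8 := by
    rw [Nat.le_div_iff_mul_le (by norm_num)]
    omega
  have hX := core_twenty_mul_ncard_fiveCircuits_add_le M hfree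
  rw [hn, show Nat.choose (44 - 3) 2 = 820 by decide, show Nat.choose 44 4 = 135751 by decide] at hX
  have hS5 : {C : Set α | M.IsCircuit C ∧ C.ncard = 5}.ncard ≤
      (3258024 - 5576 * {C : Set α | M.IsCircuit C ∧ C.ncard = 3}.ncard) / 20 := by
    rw [Nat.le_div_iff_mul_le (by norm_num)]
    omega
  exact rls_of_cellOK14 M 7 37 _ _ _ (by norm_num) hR hn hfree le_rfl hS hS5 (by norm_num)
    (cell_seven_thirtyseven_table _ (by omega))

end S1

end PercRepro
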